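import Summits.BirchSwinnertonDyer.Rank1Residual.ManinAdditive.RowMoveHolonomy
import HarnessLib

/-!
TYPER HEADER (bsd-f2-manin-ty g16, 2026-08-29; TURNKEY-an-18 (R1)) — PROVED EDGE file, theorem-only apart from the two
bookkeeping definitions `rowAct` (right action of `SL(2, ℤ)` on rows) and `Realises` (the realisation predicate of the proof).
Nothing is asserted beyond what is proved here; no `@[conjecture]` node is added.  Cell bsd-f2-manin, an lens, MEMO-an §73.2
THEOREM 1 (HOME/an/MEMO-an-73.md; Sketch-an-g31.lean 3f780a28d6538d1f, landed as `…/ManinAdditive/RowMoveHolonomy.lean`, p680534).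

# The REALISATION EDGE, guarded form: state-closed generation ⟹ the row-move law, whenever `rad t ∣ N`

`RowMoveHolonomy.RealisationEdge` (typed obligation node, p680534) reads `∀ N t, 0 < t → StateClosedGeneration N t →
RowMoveLawAt N t`.  MEMO-an §73.2 THEOREM 1 proves it by the argument formalised below; the one step of that argument that is
not available at every `(N, t)` is the SCALING block `(c, d) ~ (t c, d)`: p3's scaling move
(`ManinLocalTwoThree.rowMoves`, `e.1 = (t * e.2.1, e.2.2)`) needs BOTH rows valid, i.e. `gcd(t c, d) = 1`, which holds at every
valid row iff every prime of `t` divides `N` (a valid row has `N ∣ c`, `gcd(c, d) = 1`, so `gcd(N, d) = 1`).  This file therefore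
proves the edge under the guard `t ∣ N ^ k` (equivalently `0 < t ∧ ∀ p prime, p ∣ t → p ∣ N`, `rowMoveLawAt_of_prime_dvd`), which
covers every level the cell uses it at: `(N, 9)` with `9 ∣ N` and `(N, 8)` with `4 ∣ N`.  Consequently the `RealisationEdge`
hypothesis of the bookkeeping edges `rowMoveLawNine_of` / `rowMoveLawEight_of` / `degeneracyLoopLawNine_of` /
`degeneracyLoopLawEight_of` is DISCHARGED: `rowMoveLawNine_of'`, `rowMoveLawEight_of'`, `degeneracyLoopLawNine_of'`,
`degeneracyLoopLawEight_of'` take `StateClosedGenerationNine` / `StateClosedGenerationEight` alone.  Whether the unguarded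
`RealisationEdge` holds at pairs `(N, t)` with a prime of `t` not dividing `N` is not decided here (the node stays an obligation;
it is not needed by any edge of the cell after this file).

PROOF (MEMO-an §73.2 THEOREM 1, followed step by step).  `Realises N t γ :⇔ γ ∈ Γ₀(N) ∧ ∀ valid v, v ~ v·γ` is closed under
`1`, products and inverses (`Γ₀(N)` preserves valid rows — a Bézout relation transports through `γ⁻¹`; `~` is an equivalence);
`−1` realises (negation move), the lower generator `(1 0; N 1)` realises (one shift), and every section generator
`𝒰 = (1 − N n′, tʰ; N c₀, 1 + N n)` with `tʰ c₀ = n − n′(1 + N n)` realises by the 5-block path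
`(c, d) ~ (tʰ c, d) ~ (x, d) ~ (x, e) ~ (x − N n′ e, e) = (tʰ y, e) ~ (y, e) = (c, d)·𝒰`
(`x = tʰ c + N n d`, `e = d + x`, `y = c(1 − N n′) + d N c₀`; scaling, shift `n`, twist `1`, shift `−n′`, un-scaling), every
station valid because `gcd(t, d′) = 1` at every valid row `(·, d′)` under the guard.  Closure induction gives `Realises` on
`closure (admissibleGen N t) ⊇ Γ₁(N)`; finally a valid `(c, d)` with `d ≡ 1 (mod N)` is the bottom row of some `γ ∈ Γ₁(N)`
(`exists_gamma0_of_rowValid` + `a ≡ 1` from `ad − bc = 1`), `(0, 1)·γ = (c, d)`, and `d ≡ −1` is reduced to `d ≡ 1` by the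
negation move.  HONEST FRAMING: an elementary group-theoretic bookkeeping theorem; it does not prove `StateClosedGenerationNine/
Eight` (E-an-144∀, OPEN — per-level certificates are TURNKEY-an-18 (R2)), nor C3, nor Manin's conjecture, nor BSD.
-/

set_option autoImplicit false

open scoped MatrixGroups
open CongruenceSubgroup Matrix.SpecialLinearGroup
open Summit.BirchSwinnertonDyer.BirchSwinnertonDyer.Theorems.ManinLocalTwoThree
open Summit.BirchSwinnertonDyer.Rank1Residual.ManinAdditive.Gamma1Lattice (DegeneracyLoopLawNine DegeneracyLoopLawEight)

namespace Summit.BirchSwinnertonDyer.Rank1Residual.ManinAdditive.RowMoveHolonomy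

/-! ## §1  The right action of `SL(2, ℤ)` on rows; `Γ₀(N)` preserves valid rows -/

/-- The right action of `SL(2, ℤ)` on row vectors: `(c, d) · γ = (c a + d c', c b + d d')` for `γ = (a b; c' d')`. -/
def rowAct (v : ℤ × ℤ) (γ : SL(2, ℤ)) : ℤ × ℤ :=
  (v.1 * γ 0 0 + v.2 * γ 1 0, v.1 * γ 0 1 + v.2 * γ 1 1)

/-- `v · 1 = v`. -/
theorem rowAct_one (v : ℤ × ℤ) : rowAct v 1 = v := by
  obtain ⟨c, d⟩ := v
  simp [rowAct]

/-- `v · (γ δ) = (v · γ) · δ`. -/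
theorem rowAct_mul (v : ℤ × ℤ) (γ δ : SL(2, ℤ)) : rowAct v (γ * δ) = rowAct (rowAct v γ) δ := by
  obtain ⟨c, d⟩ := v
  simp only [rowAct, Matrix.SpecialLinearGroup.coe_mul, Matrix.mul_apply, Fin.sum_univ_two, Prod.mk.injEq]
  constructor <;> ring

/-- `v · (−1) = −v`. -/
theorem rowAct_neg_one (v : ℤ × ℤ) : rowAct v (-1) = (-v.1, -v.2) := by
  obtain ⟨c, d⟩ := v
  simp [rowAct, Matrix.SpecialLinearGroup.coe_neg, Matrix.SpecialLinearGroup.coe_one]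

/-- `(0, 1) · γ` is the bottom row of `γ`. -/
theorem rowAct_zero_one (γ : SL(2, ℤ)) : rowAct (0, 1) γ = ((γ 1 0 : ℤ), (γ 1 1 : ℤ)) := by
  simp [rowAct]

/-- Valid rows stay valid under `Γ₀(N)`. -/
theorem rowAct_mem_rowValid {N : ℕ} {v : ℤ × ℤ} (hv : v ∈ rowValid N) {γ : SL(2, ℤ)} (hγ : γ ∈ Gamma0 N) :
    rowAct v γ ∈ rowValid N := by
  obtain ⟨c, d⟩ := v
  obtain ⟨hc, u, w, huw⟩ := mem_rowValid.mp hv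
  have h10 : (N : ℤ) ∣ γ 1 0 := by
    have h := Gamma0_mem.mp hγ
    exact (ZMod.intCast_zmod_eq_zero_iff_dvd _ N).mp h
  have hdet : (γ 0 0 : ℤ) * γ 1 1 - γ 0 1 * γ 1 0 = 1 := by
    have := Matrix.det_fin_two ((γ : SL(2, ℤ)) : Matrix (Fin 2) (Fin 2) ℤ)
    rw [γ.2] at this
    exact this.symm
  refine mem_rowValid.mpr ⟨?_, ?_⟩
  · exact dvd_add (dvd_mul_of_dvd_left hc _) (dvd_mul_of_dvd_right h10 _)
  · -- `(c', d') γ⁻¹ = (c, d)`, so a Bézout relation for `(c, d)` transports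
    refine ⟨u * γ 1 1 - w * γ 0 1, -(u * γ 1 0) + w * γ 0 0, ?_⟩
    linear_combination ((γ 0 0 : ℤ) * γ 1 1 - γ 0 1 * γ 1 0) * huw + hdet

/-! ## §2  Row moves as an equivalence: the elementary blocks (shift, twist, negation, scaling) -/

section Realisation

variable {N t : ℕ}

/-- shift move `(c, d) ~ (c + N k d, d)` at a valid row. -/
theorem eqvGen_shift (k : ℤ) {c d : ℤ} (hv : (c, d) ∈ rowValid N) :
    Relation.EqvGen (fun p q : ℤ × ℤ => (p, q) ∈ rowMoves N t) (c, d) (c + N * k * d, d) := by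
  refine Relation.EqvGen.rel _ _ (mem_rowMoves.mpr ⟨hv, ?_, Or.inl ⟨k, rfl⟩⟩)
  obtain ⟨hc, hcd⟩ := mem_rowValid.mp hv
  exact mem_rowValid.mpr ⟨dvd_add hc (Dvd.dvd.mul_right (dvd_mul_right _ _) _), hcd.add_mul_right_left _⟩

/-- twist move `(c, d) ~ (c, d + k c)` at a valid row. -/
theorem eqvGen_twist (k : ℤ) {c d : ℤ} (hv : (c, d) ∈ rowValid N) :
    Relation.EqvGen (fun p q : ℤ × ℤ => (p, q) ∈ rowMoves N t) (c, d) (c, d + k * c) := by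
  refine Relation.EqvGen.rel _ _ (mem_rowMoves.mpr ⟨hv, ?_, Or.inr (Or.inl ⟨k, rfl⟩)⟩)
  obtain ⟨hc, hcd⟩ := mem_rowValid.mp hv
  exact mem_rowValid.mpr ⟨hc, hcd.add_mul_right_right _⟩

/-- negation move `(c, d) ~ (−c, −d)` at a valid row. -/
theorem eqvGen_neg {c d : ℤ} (hv : (c, d) ∈ rowValid N) :
    Relation.EqvGen (fun p q : ℤ × ℤ => (p, q) ∈ rowMoves N t) (c, d) (-c, -d) := by
  refine Relation.EqvGen.rel _ _ (mem_rowMoves.mpr ⟨hv, ?_, Or.inr (Or.inr (Or.inl rfl))⟩)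
  obtain ⟨hc, hcd⟩ := mem_rowValid.mp hv
  exact mem_rowValid.mpr ⟨(dvd_neg).mpr hc, hcd.neg_neg⟩

/-- If every prime of `t` divides `N` (`t ∣ N^k`), then `t` is prime to the second entry of every valid row. -/
theorem isCoprime_t_of_rowValid {k : ℕ} (hrad : t ∣ N ^ k) {c d : ℤ} (hv : (c, d) ∈ rowValid N) :
    IsCoprime (t : ℤ) d := by
  obtain ⟨hc, hcd⟩ := mem_rowValid.mp hv
  have hN : IsCoprime (N : ℤ) d := hcd.of_isCoprime_of_dvd_left hc
  have hNk : IsCoprime ((N : ℤ) ^ k) d := hN.pow_left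
  exact hNk.of_isCoprime_of_dvd_left (by exact_mod_cast hrad)

/-- scaling: `(c, d) ~ (t^h c, d)` for a valid row (all intermediate rows are valid when `t ∣ N^k`). -/
theorem eqvGen_scale {k : ℕ} (hrad : t ∣ N ^ k) (h : ℕ) {c d : ℤ} (hv : (c, d) ∈ rowValid N) :
    Relation.EqvGen (fun p q : ℤ × ℤ => (p, q) ∈ rowMoves N t) (c, d) ((t : ℤ) ^ h * c, d) := by
  induction h with
  | zero => rw [pow_zero, one_mul]; exact Relation.EqvGen.refl _
  | succ h ih =>
    have hvh : ((t : ℤ) ^ h * c, d) ∈ rowValid N := by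
      obtain ⟨hc, hcd⟩ := mem_rowValid.mp hv
      exact mem_rowValid.mpr ⟨dvd_mul_of_dvd_right hc _,
        ((isCoprime_t_of_rowValid hrad hv).pow_left.mul_left hcd)⟩
    have hvh1 : ((t : ℤ) ^ (h + 1) * c, d) ∈ rowValid N := by
      obtain ⟨hc, hcd⟩ := mem_rowValid.mp hv
      exact mem_rowValid.mpr ⟨dvd_mul_of_dvd_right hc _,
        ((isCoprime_t_of_rowValid hrad hv).pow_left.mul_left hcd)⟩
    refine ih.trans _ _ _ (Relation.EqvGen.symm _ _ (Relation.EqvGen.rel _ _ (mem_rowMoves.mpr ⟨hvh1, hvh, ?_⟩)))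
    right; right; right
    show ((t : ℤ) ^ (h + 1) * c, d) = ((t : ℤ) * ((t : ℤ) ^ h * c), d)
    rw [pow_succ]; ring_nf

/-- The REALISATION predicate of MEMO-an §73.2 (the subgroup `H` of the proof): `γ ∈ Γ₀(N)` and every valid row is joined
to its image under `γ` by row moves at `(N, t)`. -/
structure Realises (N t : ℕ) (γ : SL(2, ℤ)) : Prop where
  /-- `γ ∈ Γ₀(N)` (so that `γ` preserves valid rows). -/
  mem : γ ∈ Gamma0 N
  /-- every valid row is row-move-equivalent to its image. -/
  path : ∀ v ∈ rowValid N, Relation.EqvGen (fun p q : ℤ × ℤ => (p, q) ∈ rowMoves N t) v (rowAct v γ)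

/-! ## §3  `Realises` is a subgroup property containing the admissible generators -/

/-- `1` realises. -/
theorem realises_one : Realises N t 1 :=
  ⟨one_mem _, fun v _ => by rw [rowAct_one]; exact Relation.EqvGen.refl _⟩

/-- products realise (transitivity + `Γ₀(N)` preserves valid rows). -/
theorem realises_mul {γ δ : SL(2, ℤ)} (hγ : Realises N t γ) (hδ : Realises N t δ) : Realises N t (γ * δ) := by
  refine ⟨mul_mem hγ.1 hδ.1, fun v hv => ?_⟩
  rw [rowAct_mul]
  exact (hγ.2 v hv).trans _ _ _ (hδ.2 _ (rowAct_mem_rowValid hv hγ.1))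

/-- inverses realise (symmetry). -/
theorem realises_inv {γ : SL(2, ℤ)} (hγ : Realises N t γ) : Realises N t γ⁻¹ := by
  refine ⟨inv_mem hγ.1, fun v hv => ?_⟩
  have hw : rowAct v γ⁻¹ ∈ rowValid N := rowAct_mem_rowValid hv (inv_mem hγ.1)
  have h := hγ.2 _ hw
  rw [← rowAct_mul, inv_mul_cancel, rowAct_one] at h
  exact h.symm _ _

/-- `−1` realises (the negation move). -/
theorem realises_neg_one : Realises N t (-1) := by
  refine ⟨by rw [Gamma0_mem]; simp, fun v hv => ?_⟩
  obtain ⟨c, d⟩ := v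
  rw [rowAct_neg_one]
  exact eqvGen_neg hv

/-- the lower generator `(1 0; N 1)` realises (one shift move, `k = 1`). -/
theorem realises_lowerGen : Realises N t (lowerGen N) := by
  refine ⟨?_, fun v hv => ?_⟩
  · rw [Gamma0_mem]; simp [lowerGen]
  · obtain ⟨c, d⟩ := v
    have e : rowAct (c, d) (lowerGen N) = (c + N * 1 * d, d) := by
      simp only [rowAct, lowerGen]; simp; ring
    rw [e]
    exact eqvGen_shift 1 hv

/-- THE 5-BLOCK PATH (MEMO-an §73.2): every section generator `(1 − N n′, tʰ; N c₀, 1 + N n)` realises, under the guard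
`t ∣ N ^ k` (which makes every station of the path a valid row). -/
theorem realises_of_mem_sectionGen {k : ℕ} (hrad : t ∣ N ^ k) {γ : SL(2, ℤ)} (hγ : γ ∈ sectionGen N t) :
    Realises N t γ := by
  obtain ⟨h, n, n', c₀, hc₀, hγ⟩ := hγ
  have e00 : (γ 0 0 : ℤ) = 1 - N * n' := by
    show (γ : Matrix (Fin 2) (Fin 2) ℤ) 0 0 = _; rw [hγ]; rfl
  have e01 : (γ 0 1 : ℤ) = (t : ℤ) ^ h := by
    show (γ : Matrix (Fin 2) (Fin 2) ℤ) 0 1 = _; rw [hγ]; rfl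
  have e10 : (γ 1 0 : ℤ) = N * c₀ := by
    show (γ : Matrix (Fin 2) (Fin 2) ℤ) 1 0 = _; rw [hγ]; rfl
  have e11 : (γ 1 1 : ℤ) = 1 + N * n := by
    show (γ : Matrix (Fin 2) (Fin 2) ℤ) 1 1 = _; rw [hγ]; rfl
  refine ⟨?_, fun v hv => ?_⟩
  · rw [Gamma0_mem]
    have : ((γ : Matrix (Fin 2) (Fin 2) ℤ) 1 0 : ZMod N) = 0 := by
      rw [show (γ : Matrix (Fin 2) (Fin 2) ℤ) 1 0 = (γ 1 0 : ℤ) from rfl, e10]; push_cast; simp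
    exact this
  obtain ⟨c, d⟩ := v
  obtain ⟨hc, hcd⟩ := mem_rowValid.mp hv
  -- the five stations
  set x : ℤ := (t : ℤ) ^ h * c + N * n * d with hx
  set e : ℤ := d + 1 * x with he
  set y : ℤ := c * (1 - N * n') + d * (N * c₀) with hy
  have hγv : rowAct (c, d) γ = (y, e) := by
    simp only [rowAct, e00, e01, e10, e11, hy, he, hx, Prod.mk.injEq, true_and]
    ring
  have hfin : x + N * (-n') * e = (t : ℤ) ^ h * y := by
    rw [he, hx, hy]; linear_combination (-(N : ℤ) * d) * hc₀
  -- validity of the stations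
  have hγ0 : γ ∈ Gamma0 N := by
    rw [Gamma0_mem]
    have : ((γ : Matrix (Fin 2) (Fin 2) ℤ) 1 0 : ZMod N) = 0 := by
      rw [show (γ : Matrix (Fin 2) (Fin 2) ℤ) 1 0 = (γ 1 0 : ℤ) from rfl, e10]; push_cast; simp
    exact this
  have hv1 : ((t : ℤ) ^ h * c, d) ∈ rowValid N :=
    mem_rowValid.mpr ⟨dvd_mul_of_dvd_right hc _, (isCoprime_t_of_rowValid hrad hv).pow_left.mul_left hcd⟩
  obtain ⟨hc1, hcd1⟩ := mem_rowValid.mp hv1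
  have hv2 : (x, d) ∈ rowValid N := by
    refine mem_rowValid.mpr ⟨?_, ?_⟩
    · rw [hx]; exact dvd_add hc1 (Dvd.dvd.mul_right (dvd_mul_right _ _) _)
    · rw [hx]; exact hcd1.add_mul_right_left _
  obtain ⟨hc2, hcd2⟩ := mem_rowValid.mp hv2
  have hv3 : (x, e) ∈ rowValid N := by
    refine mem_rowValid.mpr ⟨hc2, ?_⟩
    rw [he]; exact hcd2.add_mul_right_right _
  have hv5 : (y, e) ∈ rowValid N := by rw [← hγv]; exact rowAct_mem_rowValid hv hγ0
  -- the path
  rw [hγv]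
  have s1 := eqvGen_scale (t := t) hrad h hv
  have s2 := eqvGen_shift (t := t) n hv1
  have s3 := eqvGen_twist (t := t) 1 hv2
  have s4 : Relation.EqvGen (fun p q : ℤ × ℤ => (p, q) ∈ rowMoves N t) (x, e) ((t : ℤ) ^ h * y, e) := by
    have := eqvGen_shift (t := t) (-n') hv3
    rwa [hfin] at this
  have s5 := (eqvGen_scale (t := t) hrad h hv5).symm _ _
  rw [← hx] at s2
  rw [← he] at s3
  exact s1.trans _ _ _ (s2.trans _ _ _ (s3.trans _ _ _ (s4.trans _ _ _ s5)))

/-- Every element of the closure of the admissible generators realises (closure induction). -/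
theorem realises_of_mem_closure {k : ℕ} (hrad : t ∣ N ^ k) {γ : SL(2, ℤ)}
    (hγ : γ ∈ Subgroup.closure (admissibleGen N t)) : Realises N t γ := by
  induction hγ using Subgroup.closure_induction with
  | mem x hx =>
    rcases Set.mem_insert_iff.mp hx with rfl | hx
    · exact realises_neg_one
    · rcases Set.mem_insert_iff.mp hx with rfl | hx
      · exact realises_lowerGen
      · exact realises_of_mem_sectionGen hrad hx
  | one => exact realises_one
  | mul x y _ _ hx hy => exact realises_mul hx hy
  | inv x _ hx => exact realises_inv hx

/-! ## §4  The edge -/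

/-- `(0, 1)` is a valid row. -/
theorem zero_one_mem_rowValid : ((0 : ℤ), (1 : ℤ)) ∈ rowValid N :=
  mem_rowValid.mpr ⟨dvd_zero _, isCoprime_one_right⟩

/-- a valid row with `d ≡ 1 (mod N)` is the bottom row of an element of `Γ₁(N)`. -/
theorem exists_gamma1_of_rowValid {c d : ℤ} (hv : (c, d) ∈ rowValid N) (hd : ((d : ℤ) : ZMod N) = 1) :
    ∃ γ : SL(2, ℤ), γ ∈ Gamma1 N ∧ (γ 1 0 : ℤ) = c ∧ (γ 1 1 : ℤ) = d := by
  obtain ⟨γ, h10, h11⟩ := exists_gamma0_of_rowValid hv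
  refine ⟨γ, ?_, h10, h11⟩
  have hdet : ((γ : SL(2, ℤ)) 0 0 : ℤ) * (γ : SL(2, ℤ)) 1 1 - ((γ : SL(2, ℤ)) 0 1 : ℤ) * (γ : SL(2, ℤ)) 1 0 = 1 := by
    have := Matrix.det_fin_two ((γ : SL(2, ℤ)) : Matrix (Fin 2) (Fin 2) ℤ)
    rw [(γ : SL(2, ℤ)).2] at this
    exact this.symm
  have h10' : (((γ : SL(2, ℤ)) 1 0 : ℤ) : ZMod N) = 0 := Gamma0_mem.mp γ.2
  have h11' : (((γ : SL(2, ℤ)) 1 1 : ℤ) : ZMod N) = 1 := by rw [h11]; exact hd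
  rw [Gamma1_mem]
  refine ⟨?_, h11', h10'⟩
  have := congrArg (Int.cast : ℤ → ZMod N) hdet
  push_cast at this
  rw [h10', h11'] at this
  simpa using this

/-- **THE REALISATION EDGE, guarded form (TURNKEY-an-18 (R1); an MEMO §73.2 THEOREM 1):** if every prime of `t` divides `N`
(`t ∣ N ^ k`), state-closed generation implies the row-move law at `(N, t)`. -/
theorem rowMoveLawAt_of_stateClosedGeneration {k : ℕ} (hrad : t ∣ N ^ k) (hgen : StateClosedGeneration N t) :
    RowMoveLawAt N t := by
  intro c d hv hd
  rcases hd with hd | hd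
  · obtain ⟨γ, hγ1, h10, h11⟩ := exists_gamma1_of_rowValid hv hd
    have h := (realises_of_mem_closure hrad (hgen hγ1)).2 (0, 1) zero_one_mem_rowValid
    rw [rowAct_zero_one, h10, h11] at h
    exact h.symm _ _
  · have hv' : (-c, -d) ∈ rowValid N := by
      obtain ⟨hc, hcd⟩ := mem_rowValid.mp hv
      exact mem_rowValid.mpr ⟨(dvd_neg).mpr hc, hcd.neg_neg⟩
    have hd' : (((-d : ℤ)) : ZMod N) = 1 := by push_cast; rw [hd, neg_neg]
    obtain ⟨γ, hγ1, h10, h11⟩ := exists_gamma1_of_rowValid hv' hd'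
    have h := (realises_of_mem_closure hrad (hgen hγ1)).2 (0, 1) zero_one_mem_rowValid
    rw [rowAct_zero_one, h10, h11] at h
    exact (eqvGen_neg hv).trans _ _ _ (h.symm _ _)

/-- `0 < t` and every prime of `t` divides `N` ⟹ `t ∣ N ^ t` (the guard in prime form implies the guard in power form). -/
theorem dvd_pow_self_of_prime_dvd (ht : 0 < t) (h : ∀ p : ℕ, p.Prime → p ∣ t → p ∣ N) : t ∣ N ^ t := by
  rcases Nat.eq_zero_or_pos N with rfl | hN
  · rw [zero_pow ht.ne']
    exact dvd_zero _
  · rw [← Nat.factorization_le_iff_dvd ht.ne' (pow_ne_zero _ hN.ne'), Finsupp.le_def]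
    intro p
    rw [Nat.factorization_pow, Finsupp.smul_apply, smul_eq_mul]
    by_cases hp : p.Prime ∧ p ∣ t
    · obtain ⟨hp, hpt⟩ := hp
      have h1 : 1 ≤ N.factorization p := hp.factorization_pos_of_dvd hN.ne' (h p hp hpt)
      calc t.factorization p ≤ t := (Nat.factorization_lt p ht.ne').le
        _ = t * 1 := (mul_one _).symm
        _ ≤ t * N.factorization p := Nat.mul_le_mul_left _ h1
    · have h0 : t.factorization p = 0 := by
        rw [Nat.factorization_eq_zero_iff]
        rcases not_and_or.mp hp with h1 | h1
        · exact Or.inl h1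
        · exact Or.inr (Or.inl h1)
      rw [h0]
      exact Nat.zero_le _

/-- **THE REALISATION EDGE, guarded form in prime language:** `0 < t`, every prime of `t` divides `N`, and state-closed
generation at `(N, t)` imply the row-move law at `(N, t)` (`RealisationEdge` restricted to `rad t ∣ N`). -/
theorem rowMoveLawAt_of_prime_dvd (ht : 0 < t) (h : ∀ p : ℕ, p.Prime → p ∣ t → p ∣ N)
    (hgen : StateClosedGeneration N t) : RowMoveLawAt N t :=
  rowMoveLawAt_of_stateClosedGeneration (dvd_pow_self_of_prime_dvd ht h) hgen

end Realisation

/-! ## §5  The bookkeeping edges of `RowMoveHolonomy` §4 with the `RealisationEdge` hypothesis discharged -/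

/-- E-an-144∀(9) ALONE implies p3's `RowMoveLawNine` (`9 ∣ N ^ 1` at every level with `3 ^ 2 ∣ N`). -/
theorem rowMoveLawNine_of' (h : StateClosedGenerationNine) : RowMoveLawNine :=
  fun N hN => rowMoveLawAt_of_stateClosedGeneration (k := 1) (by rw [pow_one]; norm_num at hN; exact hN) (h N hN)

/-- E-an-144∀(8) ALONE implies p3's `RowMoveLawEight` (`8 ∣ N ^ 2` at every level with `2 ^ 2 ∣ N`). -/
theorem rowMoveLawEight_of' (h : StateClosedGenerationEight) : RowMoveLawEight :=
  fun N hN => rowMoveLawAt_of_stateClosedGeneration (k := 2)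
    (by obtain ⟨m, rfl⟩ := hN; exact ⟨2 * m ^ 2, by ring⟩) (h N hN)

/-- … hence p3's `DegeneracyLoopLawNine` from E-an-144∀(9) alone. -/
theorem degeneracyLoopLawNine_of' (h : StateClosedGenerationNine) : DegeneracyLoopLawNine :=
  degeneracyLoopLawNine_of_rowMoveLawNine (rowMoveLawNine_of' h)

/-- … and p3's `DegeneracyLoopLawEight` from E-an-144∀(8) alone. -/
theorem degeneracyLoopLawEight_of' (h : StateClosedGenerationEight) : DegeneracyLoopLawEight :=
  degeneracyLoopLawEight_of_rowMoveLawEight (rowMoveLawEight_of' h)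

end Summit.BirchSwinnertonDyer.Rank1Residual.ManinAdditive.RowMoveHolonomy
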